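import Summits.HodgeConjecture.HodgeConjecture.Theorems.PadicSemiregularLiftFermatAnchorAssemblyGMFDefs

/-!
# The `ℤ`-graded Hom complex of a pair of graded matrix factorizations, I: cochains (line `witt-lift-rigid-mf`)

Crux `FermatAnchorAssembly` (stmt-HodgeConjecture-14874), stub `stub_eulerBaseChange`; vocabulary
`Theorems/PadicSemiregularLiftFermatAnchorAssemblyGMFDefs.lean` (`GMFData.cochainSet/closedSet/nullSet/homDim`),
which describes `Hom(M, N(t))` in the homotopy category of `L`-graded matrix factorizations by SETS of pairs
of polynomial matrices. This file gives them their linear structure over any commutative coefficient ring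
`A` (needed over `𝕜`, `𝕎 𝕜`, `Frac 𝕎 𝕜`): `homogSet m L d c` (exponents of bidegree `(d, c mod L)`) and
the closure of `IsBihom` under `0, +, •, −, Σ, ·`; the even / odd differentials
`GMFData.dMap M N : (a, b) ↦ (ψ_N a − b ψ_M, φ_N b − a φ_M)`, `GMFData.hMap M N : (s, u) ↦ (u ψ_M + φ_N s,
s φ_M + ψ_N u)` (linear over `A[x]`; for LAWFUL `M, N` they compose to zero both ways, `φψ = ψφ = f·1`);
the submodules `cochainSub` (= `cochainSet`), `oddSub` (`oddSet` = the `(s, u)` of `nullSet`),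
`closedSub = cochainSub ⊓ ker dMap` (= `closedSet`), `nullSub = hMap (oddSub)` (= `nullSet`); the bookkeeping
`hMap (odd t) ⊆ even t`, `dMap (even t) ⊆ odd (t + m)`; and the registered sub-goal
`nullSet_subset_closedSet` (the vocabulary audit's "null ⊆ closed" for lawful pairs, kernel-checked).
All `[folklore]`; no named fact, no `sorry`.
-/

-- `Summit.HodgeConjecture.HodgeConjecture.…` is the tree's mandated summit/problem namespace (single-problem summit).
set_option linter.dupNamespace false

noncomputable section

open Finset

namespace Summit.HodgeConjecture.HodgeConjecture.Cruxes.FermatAnchorAssembly.WittLiftRigidMf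

/-! ### Bidegrees of exponents -/

/-- The exponents `e` of bidegree `(d, c mod L)`: `|e| = d` and `e mod m ≡ c (mod L)`. [folklore] -/
def homogSet {ν : ℕ} (m : ℕ) (L : AddSubgroup (Fin ν → ZMod m)) (d : ℤ) (c : Fin ν → ZMod m) :
    Set (Fin ν →₀ ℕ) :=
  {e | zdeg e = d ∧ gdeg m e - c ∈ L}

variable {ν m : ℕ}

/-- Membership in `homogSet`. [folklore] -/
theorem mem_homogSet {L : AddSubgroup (Fin ν → ZMod m)} {d : ℤ} {c : Fin ν → ZMod m} {e : Fin ν →₀ ℕ} :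
    e ∈ homogSet m L d c ↔ zdeg e = d ∧ gdeg m e - c ∈ L := Iff.rfl

/-- `ℤ`-degree is additive. [folklore] -/
theorem zdeg_add (e₁ e₂ : Fin ν →₀ ℕ) : zdeg (e₁ + e₂) = zdeg e₁ + zdeg e₂ := by
  simp only [zdeg, Finsupp.coe_add, Pi.add_apply, Finset.sum_add_distrib, Nat.cast_add]

/-- The character of a product of monomials is the sum of the characters. [folklore] -/
theorem gdeg_add (e₁ e₂ : Fin ν →₀ ℕ) : gdeg m (e₁ + e₂) = gdeg m e₁ + gdeg m e₂ := by
  funext i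
  simp only [gdeg, Finsupp.coe_add, Pi.add_apply, Nat.cast_add]

/-- Bidegrees add: if `e₂` has bidegree `(d', c')` then `e₁ + e₂` has bidegree `(d, c)` iff `e₁` has
bidegree `(d − d', c − c')`. [folklore] -/
theorem add_mem_homogSet_iff {L : AddSubgroup (Fin ν → ZMod m)} {d d' : ℤ} {c c' : Fin ν → ZMod m}
    {e₁ e₂ : Fin ν →₀ ℕ} (h₂ : e₂ ∈ homogSet m L d' c') :
    e₁ + e₂ ∈ homogSet m L d c ↔ e₁ ∈ homogSet m L (d - d') (c - c') := by
  rcases h₂ with ⟨hd₂, hc₂⟩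
  simp only [mem_homogSet, zdeg_add, gdeg_add, hd₂]
  constructor
  · rintro ⟨hd, hc⟩
    refine ⟨by omega, ?_⟩
    have : gdeg m e₁ - (c - c') = (gdeg m e₁ + gdeg m e₂ - c) - (gdeg m e₂ - c') := by abel
    rw [this]
    exact L.sub_mem hc hc₂
  · rintro ⟨hd, hc⟩
    refine ⟨by omega, ?_⟩
    have : gdeg m e₁ + gdeg m e₂ - c = (gdeg m e₁ - (c - c')) + (gdeg m e₂ - c') := by abel
    rw [this]
    exact L.add_mem hc hc₂

/-! ### Closure properties of bihomogeneity -/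

namespace IsBihom

variable {R : Type} [CommRing R] {L : AddSubgroup (Fin ν → ZMod m)} {d d₁ d₂ : ℤ} {c c₁ c₂ : Fin ν → ZMod m}
  {q q₁ q₂ : MvPolynomial (Fin ν) R}

/-- `0` is bihomogeneous of every bidegree. [folklore] -/
theorem zero : IsBihom m L (0 : MvPolynomial (Fin ν) R) d c := by
  intro e he
  simp at he

/-- Sums of bihomogeneous polynomials of the same bidegree are bihomogeneous. [folklore] -/
theorem add (h₁ : IsBihom m L q₁ d c) (h₂ : IsBihom m L q₂ d c) : IsBihom m L (q₁ + q₂) d c := by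
  classical
  intro e he
  rcases Finset.mem_union.mp (MvPolynomial.support_add he) with h | h
  · exact h₁ e h
  · exact h₂ e h

/-- Scalar multiples of bihomogeneous polynomials are bihomogeneous. [folklore] -/
theorem smul {S : Type} [SMulZeroClass S R] (a : S) (h : IsBihom m L q d c) : IsBihom m L (a • q) d c :=
  fun e he ↦ h e (MvPolynomial.support_smul he)

/-- Negatives of bihomogeneous polynomials are bihomogeneous. [folklore] -/
theorem neg (h : IsBihom m L q d c) : IsBihom m L (-q) d c := by
  intro e he
  rw [MvPolynomial.support_neg] at he
  exact h e he

/-- Differences of bihomogeneous polynomials are bihomogeneous. [folklore] -/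
theorem sub (h₁ : IsBihom m L q₁ d c) (h₂ : IsBihom m L q₂ d c) : IsBihom m L (q₁ - q₂) d c := by
  rw [sub_eq_add_neg]
  exact h₁.add h₂.neg

/-- Finite sums of bihomogeneous polynomials are bihomogeneous. [folklore] -/
theorem sum {ι : Type} (s : Finset ι) (f : ι → MvPolynomial (Fin ν) R)
    (h : ∀ i ∈ s, IsBihom m L (f i) d c) : IsBihom m L (∑ i ∈ s, f i) d c := by
  classical
  induction s using Finset.induction_on with
  | empty => simpa using (zero : IsBihom m L (0 : MvPolynomial (Fin ν) R) d c)
  | insert a s ha ih =>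
    rw [Finset.sum_insert ha]
    exact (h a (Finset.mem_insert_self a s)).add (ih fun i hi ↦ h i (Finset.mem_insert_of_mem hi))

/-- Products of bihomogeneous polynomials are bihomogeneous, of the sum bidegree. [folklore] -/
theorem mul (h₁ : IsBihom m L q₁ d₁ c₁) (h₂ : IsBihom m L q₂ d₂ c₂) (hd : d₁ + d₂ = d)
    (hc : c₁ + c₂ = c) : IsBihom m L (q₁ * q₂) d c := by
  classical
  intro e he
  obtain ⟨e₁, he₁, e₂, he₂, rfl⟩ := Finset.mem_add.mp (MvPolynomial.support_mul q₁ q₂ he)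
  have h₂' : e₂ ∈ homogSet m L d₂ c₂ := h₂ e₂ he₂
  rw [← mem_homogSet, add_mem_homogSet_iff h₂']
  have h₁' : e₁ ∈ homogSet m L d₁ c₁ := h₁ e₁ he₁
  convert h₁' using 2
  · omega
  · rw [← hc]; abel

end IsBihom

/-! ### Odd cochains; cochains as submodules -/

namespace GMFData

variable {A : Type} [CommRing A] {ι₀ ι₁ κ₀ κ₁ : Type}

/-- ODD COCHAINS of twist `t` and `L`-degree `0` from `M` to `N`: pairs `(s : F⁰_M → F¹_N(t),
u : F¹_M(m) → F⁰_N(t))` of bihomogeneous matrices — exactly the `(s, u)` quantified in `nullSet`. [folklore] -/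
def oddSet (m : ℕ) (L : AddSubgroup (Fin ν → ZMod m)) (t : ℤ) (M : GMFData A ν m ι₀ ι₁)
    (N : GMFData A ν m κ₀ κ₁) :
    Set (Matrix κ₁ ι₀ (MvPolynomial (Fin ν) A) × Matrix κ₀ ι₁ (MvPolynomial (Fin ν) A)) :=
  {su | (∀ l i, IsBihom m L (su.1 l i) (M.d₀ i - N.d₁ l + t) (M.c₀ i - N.c₁ l)) ∧
    (∀ k j, IsBihom m L (su.2 k j) (M.d₁ j - m - N.d₀ k + t) (M.c₁ j - N.c₀ k))}

/-- Even cochains of twist `t` as an `A`-submodule (carrier: the vocabulary's `cochainSet`). [folklore] -/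
def cochainSub (L : AddSubgroup (Fin ν → ZMod m)) (t : ℤ) (M : GMFData A ν m ι₀ ι₁)
    (N : GMFData A ν m κ₀ κ₁) :
    Submodule A (Matrix κ₀ ι₀ (MvPolynomial (Fin ν) A) × Matrix κ₁ ι₁ (MvPolynomial (Fin ν) A)) where
  carrier := cochainSet m L t M N
  zero_mem' := ⟨fun _ _ ↦ IsBihom.zero, fun _ _ ↦ IsBihom.zero⟩
  add_mem' hx hy := ⟨fun k i ↦ (hx.1 k i).add (hy.1 k i), fun l j ↦ (hx.2 l j).add (hy.2 l j)⟩
  smul_mem' a _ hx := ⟨fun k i ↦ (hx.1 k i).smul a, fun l j ↦ (hx.2 l j).smul a⟩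

/-- Odd cochains of twist `t` as an `A`-submodule (carrier: `oddSet`). [folklore] -/
def oddSub (L : AddSubgroup (Fin ν → ZMod m)) (t : ℤ) (M : GMFData A ν m ι₀ ι₁)
    (N : GMFData A ν m κ₀ κ₁) :
    Submodule A (Matrix κ₁ ι₀ (MvPolynomial (Fin ν) A) × Matrix κ₀ ι₁ (MvPolynomial (Fin ν) A)) where
  carrier := oddSet m L t M N
  zero_mem' := ⟨fun _ _ ↦ IsBihom.zero, fun _ _ ↦ IsBihom.zero⟩
  add_mem' hx hy := ⟨fun l i ↦ (hx.1 l i).add (hy.1 l i), fun k j ↦ (hx.2 k j).add (hy.2 k j)⟩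
  smul_mem' a _ hx := ⟨fun l i ↦ (hx.1 l i).smul a, fun k j ↦ (hx.2 k j).smul a⟩

/-- The carrier of `cochainSub` is `cochainSet`. [folklore] -/
@[simp] theorem mem_cochainSub {L : AddSubgroup (Fin ν → ZMod m)} {t : ℤ} {M : GMFData A ν m ι₀ ι₁}
    {N : GMFData A ν m κ₀ κ₁}
    {ab : Matrix κ₀ ι₀ (MvPolynomial (Fin ν) A) × Matrix κ₁ ι₁ (MvPolynomial (Fin ν) A)} :
    ab ∈ cochainSub L t M N ↔ ab ∈ cochainSet m L t M N := Iff.rfl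

/-- The carrier of `oddSub` is `oddSet`. [folklore] -/
@[simp] theorem mem_oddSub {L : AddSubgroup (Fin ν → ZMod m)} {t : ℤ} {M : GMFData A ν m ι₀ ι₁}
    {N : GMFData A ν m κ₀ κ₁}
    {su : Matrix κ₁ ι₀ (MvPolynomial (Fin ν) A) × Matrix κ₀ ι₁ (MvPolynomial (Fin ν) A)} :
    su ∈ oddSub L t M N ↔ su ∈ oddSet m L t M N := Iff.rfl

/-! ### The even and odd differentials of the Hom complex -/

variable [Fintype ι₀] [Fintype ι₁] [Fintype κ₀] [Fintype κ₁]

/-- The EVEN differential of the Hom complex of the pair `(M, N)`: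
`(a, b) ↦ (ψ_N a − b ψ_M, φ_N b − a φ_M)`; its kernel on cochains of twist `t` is `closedSet`, its image
lies in the odd cochains of twist `t + m`. Linear over `A[x]`. [cite: BallardFaveroKatzarkov2011, §2 (morphisms of graded MFs)] -/
def dMap (M : GMFData A ν m ι₀ ι₁) (N : GMFData A ν m κ₀ κ₁) :
    (Matrix κ₀ ι₀ (MvPolynomial (Fin ν) A) × Matrix κ₁ ι₁ (MvPolynomial (Fin ν) A)) →ₗ[MvPolynomial (Fin ν) A]
      (Matrix κ₁ ι₀ (MvPolynomial (Fin ν) A) × Matrix κ₀ ι₁ (MvPolynomial (Fin ν) A)) where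
  toFun ab := (N.ψ * ab.1 - ab.2 * M.ψ, N.φ * ab.2 - ab.1 * M.φ)
  map_add' x y := by
    simp only [Prod.fst_add, Prod.snd_add, Matrix.mul_add, Matrix.add_mul, Prod.mk_add_mk]
    congr 1 <;> abel
  map_smul' r x := by
    simp only [Prod.smul_fst, Prod.smul_snd, Matrix.mul_smul, Matrix.smul_mul, RingHom.id_apply,
      Prod.smul_mk, smul_sub]

/-- The ODD differential (the null-homotopy map) of the Hom complex of the pair `(M, N)`:
`(s, u) ↦ (u ψ_M + φ_N s, s φ_M + ψ_N u)`; its image on odd cochains of twist `t` is `nullSet`.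
Linear over `A[x]`. [cite: BallardFaveroKatzarkov2011, §2 (homotopies of graded MFs)] -/
def hMap (M : GMFData A ν m ι₀ ι₁) (N : GMFData A ν m κ₀ κ₁) :
    (Matrix κ₁ ι₀ (MvPolynomial (Fin ν) A) × Matrix κ₀ ι₁ (MvPolynomial (Fin ν) A)) →ₗ[MvPolynomial (Fin ν) A]
      (Matrix κ₀ ι₀ (MvPolynomial (Fin ν) A) × Matrix κ₁ ι₁ (MvPolynomial (Fin ν) A)) where
  toFun su := (su.2 * M.ψ + N.φ * su.1, su.1 * M.φ + N.ψ * su.2)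
  map_add' x y := by
    simp only [Prod.fst_add, Prod.snd_add, Matrix.mul_add, Matrix.add_mul, Prod.mk_add_mk]
    congr 1 <;> abel
  map_smul' r x := by
    simp only [Prod.smul_fst, Prod.smul_snd, Matrix.mul_smul, Matrix.smul_mul, RingHom.id_apply,
      Prod.smul_mk, smul_add]

/-- Formula for `dMap`. [folklore] -/
@[simp] theorem dMap_apply (M : GMFData A ν m ι₀ ι₁) (N : GMFData A ν m κ₀ κ₁)
    (ab : Matrix κ₀ ι₀ (MvPolynomial (Fin ν) A) × Matrix κ₁ ι₁ (MvPolynomial (Fin ν) A)) :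
    dMap M N ab = (N.ψ * ab.1 - ab.2 * M.ψ, N.φ * ab.2 - ab.1 * M.φ) := rfl

/-- Formula for `hMap`. [folklore] -/
@[simp] theorem hMap_apply (M : GMFData A ν m ι₀ ι₁) (N : GMFData A ν m κ₀ κ₁)
    (su : Matrix κ₁ ι₀ (MvPolynomial (Fin ν) A) × Matrix κ₀ ι₁ (MvPolynomial (Fin ν) A)) :
    hMap M N su = (su.2 * M.ψ + N.φ * su.1, su.1 * M.φ + N.ψ * su.2) := rfl

/-- `closedSet` is the part of `cochainSet` killed by `dMap`. [folklore] -/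
theorem mem_closedSet_iff (L : AddSubgroup (Fin ν → ZMod m)) (t : ℤ) (M : GMFData A ν m ι₀ ι₁)
    (N : GMFData A ν m κ₀ κ₁)
    (ab : Matrix κ₀ ι₀ (MvPolynomial (Fin ν) A) × Matrix κ₁ ι₁ (MvPolynomial (Fin ν) A)) :
    ab ∈ closedSet m L t M N ↔ ab ∈ cochainSet m L t M N ∧ dMap M N ab = 0 := by
  rw [dMap_apply, Prod.mk_eq_zero, sub_eq_zero, sub_eq_zero]
  change (ab ∈ cochainSet m L t M N ∧ ab.1 * M.φ = N.φ * ab.2 ∧ N.ψ * ab.1 = ab.2 * M.ψ) ↔ _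
  constructor
  · rintro ⟨h, h₁, h₂⟩
    exact ⟨h, h₂, h₁.symm⟩
  · rintro ⟨h, h₁, h₂⟩
    exact ⟨h, h₂.symm, h₁⟩

/-- `nullSet` is the image of the odd cochains under `hMap`. [folklore] -/
theorem nullSet_eq_image (L : AddSubgroup (Fin ν → ZMod m)) (t : ℤ) (M : GMFData A ν m ι₀ ι₁)
    (N : GMFData A ν m κ₀ κ₁) : nullSet m L t M N = hMap M N '' oddSet m L t M N := by
  ext ab
  simp only [Set.mem_image, Prod.exists]
  constructor
  · rintro ⟨s, u, hs, hu, h₁, h₂⟩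
    exact ⟨s, u, ⟨hs, hu⟩, Prod.ext h₁.symm h₂.symm⟩
  · rintro ⟨s, u, ⟨hs, hu⟩, h⟩
    exact ⟨s, u, hs, hu, by rw [← h]; rfl, by rw [← h]; rfl⟩

/-- CLOSED even cochains of twist `t` as an `A`-submodule: `cochainSub ⊓ ker dMap`. [folklore] -/
def closedSub (L : AddSubgroup (Fin ν → ZMod m)) (t : ℤ) (M : GMFData A ν m ι₀ ι₁)
    (N : GMFData A ν m κ₀ κ₁) :
    Submodule A (Matrix κ₀ ι₀ (MvPolynomial (Fin ν) A) × Matrix κ₁ ι₁ (MvPolynomial (Fin ν) A)) :=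
  cochainSub L t M N ⊓ (LinearMap.ker (dMap M N)).restrictScalars A

/-- NULL-HOMOTOPIC even cochains of twist `t` as an `A`-submodule: `hMap (oddSub)`. [folklore] -/
def nullSub (L : AddSubgroup (Fin ν → ZMod m)) (t : ℤ) (M : GMFData A ν m ι₀ ι₁)
    (N : GMFData A ν m κ₀ κ₁) :
    Submodule A (Matrix κ₀ ι₀ (MvPolynomial (Fin ν) A) × Matrix κ₁ ι₁ (MvPolynomial (Fin ν) A)) :=
  (oddSub L t M N).map ((hMap M N).restrictScalars A)

/-- Membership in `closedSub`. [folklore] -/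
theorem mem_closedSub {L : AddSubgroup (Fin ν → ZMod m)} {t : ℤ} {M : GMFData A ν m ι₀ ι₁}
    {N : GMFData A ν m κ₀ κ₁}
    {ab : Matrix κ₀ ι₀ (MvPolynomial (Fin ν) A) × Matrix κ₁ ι₁ (MvPolynomial (Fin ν) A)} :
    ab ∈ closedSub L t M N ↔ ab ∈ cochainSet m L t M N ∧ dMap M N ab = 0 := by
  simp [closedSub]

/-- Membership in `nullSub`. [folklore] -/
theorem mem_nullSub {L : AddSubgroup (Fin ν → ZMod m)} {t : ℤ} {M : GMFData A ν m ι₀ ι₁}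
    {N : GMFData A ν m κ₀ κ₁}
    {ab : Matrix κ₀ ι₀ (MvPolynomial (Fin ν) A) × Matrix κ₁ ι₁ (MvPolynomial (Fin ν) A)} :
    ab ∈ nullSub L t M N ↔ ∃ su ∈ oddSet m L t M N, hMap M N su = ab := by
  simp [nullSub]

/-- The carrier of `closedSub` is the vocabulary's `closedSet`. [folklore] -/
theorem coe_closedSub (L : AddSubgroup (Fin ν → ZMod m)) (t : ℤ) (M : GMFData A ν m ι₀ ι₁)
    (N : GMFData A ν m κ₀ κ₁) :
    (closedSub L t M N : Set _) = closedSet m L t M N := by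
  ext ab
  rw [mem_closedSet_iff, SetLike.mem_coe, mem_closedSub]

/-- The carrier of `nullSub` is the vocabulary's `nullSet`. [folklore] -/
theorem coe_nullSub (L : AddSubgroup (Fin ν → ZMod m)) (t : ℤ) (M : GMFData A ν m ι₀ ι₁)
    (N : GMFData A ν m κ₀ κ₁) :
    (nullSub L t M N : Set _) = nullSet m L t M N := by
  ext ab
  rw [nullSet_eq_image, SetLike.mem_coe, mem_nullSub, Set.mem_image]

/-! ### Lawful pairs: the two differentials compose to zero -/

variable [DecidableEq ι₀] [DecidableEq ι₁] [DecidableEq κ₀] [DecidableEq κ₁]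

/-- For lawful `M, N`: `dMap ∘ hMap = 0` (null-homotopic cochains are closed):
`ψ_N (uψ_M + φ_N s) − (sφ_M + ψ_N u) ψ_M = (ψ_N φ_N) s − s (φ_M ψ_M) = f s − s f = 0`, etc. [folklore] -/
theorem dMap_hMap {L : AddSubgroup (Fin ν → ZMod m)} (M : GMF A ν m L ι₀ ι₁) (N : GMF A ν m L κ₀ κ₁)
    (su : Matrix κ₁ ι₀ (MvPolynomial (Fin ν) A) × Matrix κ₀ ι₁ (MvPolynomial (Fin ν) A)) :
    dMap M.toGMFData N.toGMFData (hMap M.toGMFData N.toGMFData su) = 0 := by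
  obtain ⟨s, u⟩ := su
  rw [hMap_apply, dMap_apply, Prod.mk_eq_zero]
  constructor
  · change N.ψ * (u * M.ψ + N.φ * s) - (s * M.φ + N.ψ * u) * M.ψ = 0
    rw [Matrix.mul_add, Matrix.add_mul, ← Matrix.mul_assoc N.ψ N.φ s, N.ψ_mul_φ,
      Matrix.mul_assoc s M.φ M.ψ, M.φ_mul_ψ, Matrix.smul_mul, Matrix.mul_smul, Matrix.one_mul,
      Matrix.mul_one, ← Matrix.mul_assoc]
    abel
  · change N.φ * (s * M.φ + N.ψ * u) - (u * M.ψ + N.φ * s) * M.φ = 0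
    rw [Matrix.mul_add, Matrix.add_mul, ← Matrix.mul_assoc N.φ N.ψ u, N.φ_mul_ψ,
      Matrix.mul_assoc u M.ψ M.φ, M.ψ_mul_φ, Matrix.smul_mul, Matrix.mul_smul, Matrix.one_mul,
      Matrix.mul_one, ← Matrix.mul_assoc]
    abel

/-- For lawful `M, N`: `hMap ∘ dMap = 0` (the boundary of an even cochain is a cycle):
`(φ_N b − aφ_M) ψ_M + φ_N (ψ_N a − bψ_M) = −a f + f a = 0`, etc. [folklore] -/
theorem hMap_dMap {L : AddSubgroup (Fin ν → ZMod m)} (M : GMF A ν m L ι₀ ι₁) (N : GMF A ν m L κ₀ κ₁)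
    (ab : Matrix κ₀ ι₀ (MvPolynomial (Fin ν) A) × Matrix κ₁ ι₁ (MvPolynomial (Fin ν) A)) :
    hMap M.toGMFData N.toGMFData (dMap M.toGMFData N.toGMFData ab) = 0 := by
  obtain ⟨a, b⟩ := ab
  rw [dMap_apply, hMap_apply, Prod.mk_eq_zero]
  constructor
  · change (N.φ * b - a * M.φ) * M.ψ + N.φ * (N.ψ * a - b * M.ψ) = 0
    rw [Matrix.sub_mul, Matrix.mul_sub, Matrix.mul_assoc a M.φ M.ψ, M.φ_mul_ψ,
      ← Matrix.mul_assoc N.φ N.ψ a, N.φ_mul_ψ, Matrix.smul_mul, Matrix.mul_smul, Matrix.one_mul,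
      Matrix.mul_one, Matrix.mul_assoc]
    abel
  · change (N.ψ * a - b * M.ψ) * M.φ + N.ψ * (N.φ * b - a * M.φ) = 0
    rw [Matrix.sub_mul, Matrix.mul_sub, Matrix.mul_assoc b M.ψ M.φ, M.ψ_mul_φ,
      ← Matrix.mul_assoc N.ψ N.φ b, N.ψ_mul_φ, Matrix.smul_mul, Matrix.mul_smul, Matrix.one_mul,
      Matrix.mul_one, Matrix.mul_assoc]
    abel

/-! ### Bidegree bookkeeping: `hMap (odd t) ⊆ even t`, `dMap (even t) ⊆ odd (t + m)` -/

/-- `hMap` maps odd cochains of twist `t` to even cochains of twist `t`. [folklore] -/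
theorem hMap_mem_cochainSet {L : AddSubgroup (Fin ν → ZMod m)} (M : GMF A ν m L ι₀ ι₁)
    (N : GMF A ν m L κ₀ κ₁) (t : ℤ)
    {su : Matrix κ₁ ι₀ (MvPolynomial (Fin ν) A) × Matrix κ₀ ι₁ (MvPolynomial (Fin ν) A)}
    (h : su ∈ oddSet m L t M.toGMFData N.toGMFData) :
    hMap M.toGMFData N.toGMFData su ∈ cochainSet m L t M.toGMFData N.toGMFData := by
  obtain ⟨s, u⟩ := su
  obtain ⟨hs, hu⟩ := h
  refine ⟨fun k i ↦ ?_, fun l j ↦ ?_⟩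
  · change IsBihom m L ((u * M.ψ + N.φ * s) k i) _ _
    rw [Matrix.add_apply, Matrix.mul_apply, Matrix.mul_apply]
    refine IsBihom.add (IsBihom.sum _ _ fun j _ ↦ ?_) (IsBihom.sum _ _ fun l _ ↦ ?_)
    · exact (hu k j).mul (M.ψ_bihom j i) (by ring) (by abel)
    · exact (N.φ_bihom k l).mul (hs l i) (by ring) (by abel)
  · change IsBihom m L ((s * M.φ + N.ψ * u) l j) _ _
    rw [Matrix.add_apply, Matrix.mul_apply, Matrix.mul_apply]
    refine IsBihom.add (IsBihom.sum _ _ fun i _ ↦ ?_) (IsBihom.sum _ _ fun k _ ↦ ?_)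
    · exact (hs l i).mul (M.φ_bihom i j) (by ring) (by abel)
    · exact (N.ψ_bihom l k).mul (hu k j) (by ring) (by abel)

/-- `dMap` maps even cochains of twist `t` to odd cochains of twist `t + m`. [folklore] -/
theorem dMap_mem_oddSet {L : AddSubgroup (Fin ν → ZMod m)} (M : GMF A ν m L ι₀ ι₁)
    (N : GMF A ν m L κ₀ κ₁) (t : ℤ)
    {ab : Matrix κ₀ ι₀ (MvPolynomial (Fin ν) A) × Matrix κ₁ ι₁ (MvPolynomial (Fin ν) A)}
    (h : ab ∈ cochainSet m L t M.toGMFData N.toGMFData) :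
    dMap M.toGMFData N.toGMFData ab ∈ oddSet m L (t + m) M.toGMFData N.toGMFData := by
  obtain ⟨a, b⟩ := ab
  obtain ⟨ha, hb⟩ := h
  refine ⟨fun l i ↦ ?_, fun k j ↦ ?_⟩
  · change IsBihom m L ((N.ψ * a - b * M.ψ) l i) _ _
    rw [Matrix.sub_apply, Matrix.mul_apply, Matrix.mul_apply]
    refine IsBihom.sub (IsBihom.sum _ _ fun k _ ↦ ?_) (IsBihom.sum _ _ fun j _ ↦ ?_)
    · exact (N.ψ_bihom l k).mul (ha k i) (by ring) (by abel)
    · exact (hb l j).mul (M.ψ_bihom j i) (by ring) (by abel)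
  · change IsBihom m L ((N.φ * b - a * M.φ) k j) _ _
    rw [Matrix.sub_apply, Matrix.mul_apply, Matrix.mul_apply]
    refine IsBihom.sub (IsBihom.sum _ _ fun l _ ↦ ?_) (IsBihom.sum _ _ fun i _ ↦ ?_)
    · exact (N.φ_bihom k l).mul (hb l j) (by ring) (by abel)
    · exact (ha k i).mul (M.φ_bihom i j) (by ring) (by abel)

/-- For lawful `M, N`: null-homotopic cochains are closed, `nullSub ≤ closedSub`. [folklore] -/
theorem nullSub_le_closedSub {L : AddSubgroup (Fin ν → ZMod m)} (M : GMF A ν m L ι₀ ι₁)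
    (N : GMF A ν m L κ₀ κ₁) (t : ℤ) :
    nullSub L t M.toGMFData N.toGMFData ≤ closedSub L t M.toGMFData N.toGMFData := by
  intro ab hab
  rw [mem_nullSub] at hab
  obtain ⟨su, hsu, rfl⟩ := hab
  rw [mem_closedSub]
  exact ⟨hMap_mem_cochainSet M N t hsu, dMap_hMap M N su⟩

end GMFData

/-- **Registered sub-goal (vocabulary audit, kernel-checked): for LAWFUL `M, N` every null-homotopic
even cochain is closed**, `nullSet ⊆ closedSet` — so `homDim = dim closed − dim null` is the dimension
of a genuine cohomology group. [folklore] -/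
theorem nullSet_subset_closedSet : ∀ (A : Type) [CommRing A] (ν m : ℕ)
    (L : AddSubgroup (Fin ν → ZMod m)) (ι₀ ι₁ κ₀ κ₁ : Type) [Fintype ι₀] [Fintype ι₁] [Fintype κ₀]
    [Fintype κ₁] [DecidableEq ι₀] [DecidableEq ι₁] [DecidableEq κ₀] [DecidableEq κ₁]
    (M : GMF A ν m L ι₀ ι₁) (N : GMF A ν m L κ₀ κ₁) (t : ℤ),
    GMFData.nullSet m L t M.toGMFData N.toGMFData ⊆ GMFData.closedSet m L t M.toGMFData N.toGMFData := by
  intro A _ ν m L ι₀ ι₁ κ₀ κ₁ _ _ _ _ _ _ _ _ M N t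
  rw [← GMFData.coe_nullSub, ← GMFData.coe_closedSub]
  exact GMFData.nullSub_le_closedSub M N t

end Summit.HodgeConjecture.HodgeConjecture.Cruxes.FermatAnchorAssembly.WittLiftRigidMf

end
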